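import Summits.Ventures.LatticeQCDFlow.Scoring.ChainWindowFunctionalCLT
import Summits.Ventures.LatticeQCDFlow.Exactness.NCMCGeneralSpaceGammaMethodConsistency
import Summits.Ventures.LatticeQCDFlow.Exactness.NCMCGeneralSpaceGammaMethodStudentizedCLT

/-!
# THE Γ-METHOD FOR WINDOW FUNCTIONALS ON MARKOV-CHAIN DATA: along a chain with a Doeblin power, from
# EVERY initial law, scorer A's windowed variance statistic of the series `φ(X_i, …, X_{i+W})` is a
# CONSISTENT estimator of its Green–Kubo variance `σ²_φ`, the studentised time average is
# asymptotically `N(0, 1)`, and the printed interval has asymptotically EXACT coverage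

HONEST FRAMING: exact (Metropolis-corrected) sampling algorithms for lattice gauge theory;
figures of merit are autocorrelation/cost numbers at stated couplings and volumes; no
continuum-physics claim.

Venture `LatticeQCDFlow` (cell pub-lqcd), sub-topic `Scoring`; FANOUT row 16 (`su2-base`), GEN-10.
NEW WORK of the cell, not a published result; no definition is introduced; nothing is cited as a fact
(lag-window estimators of the spectral density at zero for functionals of finitely many coordinates of
a uniformly ergodic chain — Anderson 1971 Ch. 9, Priestley 1981 §6.2; the Γ-method, Wolff 2004; the
sliding-block chain, Meyn–Tweedie 1993 §3.4 — NAMED ONLY).  ASSEMBLY of row 13's Γ-method files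
(`Exactness/NCMCGeneralSpaceGammaMethodConsistency.chain_gammaWindow_tendstoInMeasure_of_nHit`: the
windowed statistic `Γ̂_N(0) · 2 τ̂_{N,K_N}` of `f ∘ X` converges in probability to `σ²_f` for
deterministic truncations `K_N → ∞`, `K_N³/N → 0`;
`Exactness/NCMCGeneralSpaceGammaMethodStudentizedCLT`: the studentised CLT and its exact coverage)
with GEN-9's sliding-window ('snake') chain (`Scoring/SlidingWindowChain`: Doeblin power with the same
constant, invariant window law, path-law identification) and GEN-9's variance functional
`windowLRVar` (`Scoring/ChainWindowFunctionalCLT`).  GEN-9 listed as NOT CLAIMED 'studentisation /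
printed-bar coverage on chain data (needs a consistent estimator of σ²_ℓ along the chain)' and 'a
data-driven truncation K_N → ∞'; THIS FILE supplies the estimator for EVERY bounded window functional
— in particular for the lag products `f̄(X_i) f̄(X_{i+t})` and their combinations, the influence series
of `τ̂_W` (next file), and for the one-window functionals a seat prints with a Γ-method bar: the
acceptance indicator `1{X_{i+1} ≠ X_i}` of a Metropolis stream (`W = 1`), products `f(X_i) g(X_{i+k})`.

## Content (`κ` Markov on `S`, `π` invariant, `(nHit κ m)(z, ·) ≥ ε ν` for all `z`, `ε ≠ 0`, `0 < m`;
## `φ : (Fin (W+1) → S) → ℝ` measurable, `|φ| ≤ C`; `Y_i = windowPath W X i = (X_i, …, X_{i+W})`;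
## `m_φ = E_{P_π} φ(Y_0)`, `σ²_φ = windowLRVar κ π W φ`; `u_i = φ(Y_i)` the observed series; scorer A's
## `Γ̂^u_N(t) = gammaHat u N t`, `τ̂^u_{N,K} = tauIntWindow (rhoHat u N) K`; `K_N → ∞`, `K_N³/N → 0`;
## `P_{μ₀}` row 8's chain law from ANY initial law `μ₀`)

* `tendstoInMeasure_comp_of_map_eq`, `tendstoInDistribution_comp_of_map_eq`,
  `tendsto_measure_preimage_of_map_eq` — transfer of the three modes of convergence along a measurable
  map of sample spaces (here: the window-path map, whose image law IS the window chain);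
* `windowLRVar_eq_autocov` — `σ²_φ = C_φ̄(0) + 2 Σ'_t C_φ̄(t+1)` with `C_φ̄ = autocov (windowKernel κ W) π_W φ̄`
  (row 13's form of the Green–Kubo variance, for the window chain);
* **`chain_windowGammaWindow_tendstoInMeasure_of_nHit`** — CONSISTENCY: for EVERY `μ₀`,
  `TendstoInMeasure P_{μ₀} (N ↦ Γ̂^u_N(0) · 2 τ̂^u_{N,K_N}) atTop (fun _ => σ²_φ)`;
* **`tendstoInDistribution_chain_studentized_windowAverage_of_nHit`** — THE STUDENTISED CLT
  (`σ²_φ > 0`): `(√N)⁻¹ Σ_{i<N} (φ(Y_i) − m_φ) · (√(Γ̂^u_N(0) · 2 τ̂^u_{N,K_N}))⁻¹ ⇒ N(0, 1)` under `P_{μ₀}`;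
* **`tendsto_measure_chain_studentized_windowAverage_le_of_nHit`** — EXACT ASYMPTOTIC COVERAGE
  (`z > 0`): `P_{μ₀}{|…| ≤ z} → gaussianReal 0 1 (Icc (−z) z)`: the interval
  `ū_N ± z √(2 τ̂^u_{N,K_N} Γ̂^u_N(0)/N)` covers `m_φ` with probability tending to the nominal level;
  `…_of_minorised` — the one-step certificate shape `κ(z, ·) ≥ ε ν`.

NOT CLAIMED: the automatic (data-dependent) truncation of Madras–Sokal / Wolff; `σ²_φ > 0` for a given
`φ`; rates; unbounded `φ`; chains without a Doeblin power; any number about row 16's chains.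
-/

noncomputable section

open MeasureTheory ProbabilityTheory Filter Finset Preorder Set
open scoped ENNReal NNReal Topology
open Summit.Ventures.LatticeQCDFlow.Exactness Summit.Ventures.LatticeQCDFlow.Exactness.GeneralNCMC

namespace Summit.Ventures.LatticeQCDFlow.Scoring

/-! ## Transfer of convergence along a measurable map of sample spaces -/

section Transfer

variable {α β : Type*} [MeasurableSpace α] [MeasurableSpace β] {μ : Measure α} {μ' : Measure β}
  {g : α → β}

/-- **Convergence in measure pulls back along a measurable map**: if the statistics `F_n` converge in
`μ'`-measure and `μ' = μ.map g`, then `F_n ∘ g` converge in `μ`-measure. -/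
theorem tendstoInMeasure_comp_of_map_eq (hg : AEMeasurable g μ) (hμ' : μ.map g = μ')
    {ι : Type*} {l : Filter ι} {F : ι → β → ℝ} {c : β → ℝ} (h : TendstoInMeasure μ' F l c) :
    TendstoInMeasure μ (fun n x => F n (g x)) l (fun x => c (g x)) := by
  intro δ hδ
  refine tendsto_of_tendsto_of_tendsto_of_le_of_le tendsto_const_nhds (h δ hδ)
    (fun n => zero_le) (fun n => ?_)
  rw [← hμ']
  exact Measure.le_map_apply hg {y | δ ≤ edist (F n y) (c y)}

/-- Changing the limit of a convergence in measure along an equality of functions. -/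
theorem tendstoInMeasure_congr_limit {E : Type*} [EDist E] {ι : Type*} {l : Filter ι}
    {F : ι → α → E} {c c' : α → E} (h : TendstoInMeasure μ F l c) (hc : c = c') :
    TendstoInMeasure μ F l c' := hc ▸ h

/-- **Convergence in distribution pulls back along a measurable map**: if `F_n ⇒ Z` under `μ'` and
`μ' = μ.map g`, then `F_n ∘ g ⇒ Z` under `μ`. -/
theorem tendstoInDistribution_comp_of_map_eq [IsProbabilityMeasure μ] [IsProbabilityMeasure μ']
    {E : Type*} [TopologicalSpace E] [MeasurableSpace E] [OpensMeasurableSpace E]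
    {Ω' : Type*} [MeasurableSpace Ω'] {P' : Measure Ω'} [IsProbabilityMeasure P']
    (hg : Measurable g) (hμ' : μ.map g = μ') {F : ℕ → β → E} (hF : ∀ n, Measurable (F n))
    {Z : Ω' → E} (h : TendstoInDistribution F atTop Z (fun _ => μ') P') :
    TendstoInDistribution (fun n x => F n (g x)) atTop Z (fun _ => μ) P' := by
  refine ⟨fun n => ((hF n).comp hg).aemeasurable, h.aemeasurable_limit, ?_⟩
  convert h.tendsto using 2 with n
  apply Subtype.ext
  show μ.map (fun x => F n (g x)) = μ'.map (F n)
  rw [← hμ', Measure.map_map (hF n) hg]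
  rfl

/-- **Probabilities of measurable events pull back along a measurable map**: if `μ' (A_n) → L` and
`μ' = μ.map g`, then `μ (g ⁻¹' A_n) → L`. -/
theorem tendsto_measure_preimage_of_map_eq (hg : Measurable g) (hμ' : μ.map g = μ')
    {A : ℕ → Set β} (hA : ∀ n, MeasurableSet (A n)) {L : ℝ≥0∞}
    (h : Tendsto (fun n => μ' (A n)) atTop (𝓝 L)) :
    Tendsto (fun n => μ (g ⁻¹' A n)) atTop (𝓝 L) :=
  h.congr fun n => by rw [← hμ', Measure.map_apply hg (hA n)]

end Transfer

/-! ## The Γ-method for window functionals along the chain -/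

section Chain

variable {S : Type*} [MeasurableSpace S]
variable (κ : Kernel S S) [IsMarkovKernel κ] (W : ℕ) {π : Measure S} [IsProbabilityMeasure π]
  {ν : Measure S} [IsProbabilityMeasure ν] {ε : ℝ≥0∞} {m : ℕ}

/-- **`windowLRVar` in row 13's `autocov` form, for the window chain**: with
`π_W = P_π.map (x ↦ Y_0)` and `φ̄ = φ − ∫ φ dπ_W`,
`windowLRVar κ π W φ = autocov κ_W π_W φ̄ 0 + 2 Σ'_t autocov κ_W π_W φ̄ (t+1)`. -/
theorem windowLRVar_eq_autocov (hπ : Kernel.Invariant κ π) {φ : (Fin (W + 1) → S) → ℝ}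
    (hφ : Measurable φ) {C : ℝ} (hC : ∀ v, |φ v| ≤ C) :
    windowLRVar κ π W φ
      = autocov (windowKernel κ W) ((Kernel.trajMeasure (X := fun _ : ℕ => S) π
            (fun n : ℕ => κ.comap (fun hh : (i : ↥(Finset.Iic n)) → S => hh ⟨n, Finset.mem_Iic.2 le_rfl⟩)
              (measurable_pi_apply _))).map (fun x : ℕ → S => windowPath W x 0))
          (fun y => φ y - ∫ y', φ y' ∂((Kernel.trajMeasure (X := fun _ : ℕ => S) π
            (fun n : ℕ => κ.comap (fun hh : (i : ↥(Finset.Iic n)) → S => hh ⟨n, Finset.mem_Iic.2 le_rfl⟩)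
              (measurable_pi_apply _))).map (fun x : ℕ → S => windowPath W x 0))) 0
        + 2 * ∑' t, autocov (windowKernel κ W) ((Kernel.trajMeasure (X := fun _ : ℕ => S) π
            (fun n : ℕ => κ.comap (fun hh : (i : ↥(Finset.Iic n)) → S => hh ⟨n, Finset.mem_Iic.2 le_rfl⟩)
              (measurable_pi_apply _))).map (fun x : ℕ → S => windowPath W x 0))
          (fun y => φ y - ∫ y', φ y' ∂((Kernel.trajMeasure (X := fun _ : ℕ => S) π
            (fun n : ℕ => κ.comap (fun hh : (i : ↥(Finset.Iic n)) → S => hh ⟨n, Finset.mem_Iic.2 le_rfl⟩)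
              (measurable_pi_apply _))).map (fun x : ℕ → S => windowPath W x 0))) (t + 1) := by
  rw [windowLRVar_eq_greenKubo κ W hπ hφ hC]
  unfold autocov
  simp only [Function.iterate_zero, id_eq, sq]

/-- Scorer A's windowed variance statistic of the series `u_i = φ(Y_i)` is a measurable function of
the path of the chain. -/
theorem measurable_windowGammaWindow {φ : (Fin (W + 1) → S) → ℝ} (hφ : Measurable φ) (N K : ℕ) :
    Measurable fun x : ℕ → S => gammaHat (fun i => φ (windowPath W x i)) N 0
      * (2 * tauIntWindow (rhoHat (fun i => φ (windowPath W x i)) N) K) := by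
  have h := (measurable_gammaWindow hφ N K).comp (measurable_windowPath (S := S) W)
  exact h

/-- **CONSISTENCY OF THE Γ-METHOD VARIANCE ESTIMATOR FOR A WINDOW FUNCTIONAL, FROM EVERY INITIAL
LAW.**  `κ` Markov with invariant probability `π`, `(nHit κ m)(z, ·) ≥ ε ν` for all `z` (`ε ≠ 0`,
`0 < m`); `φ` a bounded measurable function of `W + 1` consecutive states; `u_i = φ(X_i, …, X_{i+W})`;
truncations `K_N → ∞` with `K_N³/N → 0`.  Then for EVERY initial law `μ₀`, scorer A's statistic
`Γ̂^u_N(0) · 2 τ̂^u_{N,K_N}` converges IN PROBABILITY under `P_{μ₀}` to the Green–Kubo variance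
`σ²_φ = windowLRVar κ π W φ` of GEN-9's window CLT.  Proof: row 13's consistency theorem for the window
chain `windowKernel κ W` (Doeblin power `(m+W, ε, ν_W)`, invariant law `π_W`), pulled back along the
window-path map (`chain_map_windowPath`). -/
theorem chain_windowGammaWindow_tendstoInMeasure_of_nHit (hπ : Kernel.Invariant κ π) (hε : ε ≠ 0)
    (hmin : ∀ z, ε • ν ≤ nHit κ m z) (hm : 0 < m)
    {φ : (Fin (W + 1) → S) → ℝ} (hφ : Measurable φ) {C : ℝ} (hC : ∀ v, |φ v| ≤ C)
    {K : ℕ → ℕ} (hK : Tendsto K atTop atTop) (hK3 : Tendsto (fun N => (K N : ℝ) ^ 3 / N) atTop (𝓝 0))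
    (μ₀ : Measure S) [IsProbabilityMeasure μ₀] :
    TendstoInMeasure (Kernel.trajMeasure (X := fun _ : ℕ => S) μ₀
        (fun n : ℕ => κ.comap (fun hh : (i : ↥(Finset.Iic n)) → S => hh ⟨n, Finset.mem_Iic.2 le_rfl⟩)
          (measurable_pi_apply _)))
      (fun (N : ℕ) (x : ℕ → S) => gammaHat (fun i => φ (windowPath W x i)) N 0
        * (2 * tauIntWindow (rhoHat (fun i => φ (windowPath W x i)) N) (K N)))
      atTop (fun _ => windowLRVar κ π W φ) := by
  haveI : Nonempty S := nonempty_of_isProbabilityMeasure μ₀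
  haveI hπWp : IsProbabilityMeasure ((Kernel.trajMeasure (X := fun _ : ℕ => S) π
      (fun n : ℕ => κ.comap (fun hh : (i : ↥(Finset.Iic n)) → S => hh ⟨n, Finset.mem_Iic.2 le_rfl⟩)
        (measurable_pi_apply _))).map (fun x : ℕ → S => windowPath W x 0)) :=
    Measure.isProbabilityMeasure_map (measurable_windowPath_at 0).aemeasurable
  haveI hνWp : IsProbabilityMeasure ((Kernel.trajMeasure (X := fun _ : ℕ => S) ν
      (fun n : ℕ => κ.comap (fun hh : (i : ↥(Finset.Iic n)) → S => hh ⟨n, Finset.mem_Iic.2 le_rfl⟩)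
        (measurable_pi_apply _))).map (fun x : ℕ → S => windowPath W x 0)) :=
    Measure.isProbabilityMeasure_map (measurable_windowPath_at 0).aemeasurable
  haveI hμWp : IsProbabilityMeasure ((Kernel.trajMeasure (X := fun _ : ℕ => S) μ₀
      (fun n : ℕ => κ.comap (fun hh : (i : ↥(Finset.Iic n)) → S => hh ⟨n, Finset.mem_Iic.2 le_rfl⟩)
        (measurable_pi_apply _))).map (fun x : ℕ → S => windowPath W x 0)) :=
    Measure.isProbabilityMeasure_map (measurable_windowPath_at 0).aemeasurable
  have hπW := invariant_windowKernel κ W hπ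
  have hminW := windowKernel_minorised_of_nHit κ W (ν := ν) (ε := ε) (m := m) hmin
  have hmW : 0 < m + W := by omega
  have hε1 : ε ≤ 1 := by
    haveI := isMarkovKernel_nHit κ m
    exact eps_le_one_of_minorised hmin
  -- row 13's consistency theorem for the window chain, started from the law of the initial window
  have hcons := chain_gammaWindow_tendstoInMeasure_of_nHit (κ := windowKernel κ W)
    ((Kernel.trajMeasure (X := fun _ : ℕ => S) μ₀
      (fun n : ℕ => κ.comap (fun hh : (i : ↥(Finset.Iic n)) → S => hh ⟨n, Finset.mem_Iic.2 le_rfl⟩)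
        (measurable_pi_apply _))).map (fun x : ℕ → S => windowPath W x 0))
    (fun y B hB => minorised_setwise hminW y hB) (pos_iff_ne_zero.2 hε) hε1 hmW hπW hφ hC hK hK3
  -- pull back along the window-path map, whose image law is the window chain
  have key := tendstoInMeasure_comp_of_map_eq (measurable_windowPath W).aemeasurable
    (chain_map_windowPath κ W μ₀) hcons
  have hlim := (windowLRVar_eq_autocov κ W hπ hφ hC).symm
  exact tendstoInMeasure_congr_limit key (funext fun _ => hlim)

/-- **THE STUDENTISED CLT FOR THE TIME AVERAGE OF A WINDOW FUNCTIONAL, WITH THE Γ-METHOD VARIANCE,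
FROM EVERY INITIAL LAW.**  Under the hypotheses of `chain_windowGammaWindow_tendstoInMeasure_of_nHit`
and `σ²_φ = windowLRVar κ π W φ > 0`: for EVERY initial law `μ₀`, under `P_{μ₀}`,
`(√N)⁻¹ Σ_{i<N} (φ(Y_i) − m_φ) · (√(Γ̂^u_N(0) · 2 τ̂^u_{N,K_N}))⁻¹ ⇒ N(0, 1)` (the canonical variable
`id` on `(ℝ, gaussianReal 0 1)`), `m_φ = E_{P_π} φ(Y_0)`. -/
theorem tendstoInDistribution_chain_studentized_windowAverage_of_nHit (hπ : Kernel.Invariant κ π)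
    (hε : ε ≠ 0) (hmin : ∀ z, ε • ν ≤ nHit κ m z) (hm : 0 < m)
    {φ : (Fin (W + 1) → S) → ℝ} (hφ : Measurable φ) {C : ℝ} (hC : ∀ v, |φ v| ≤ C)
    (hσ : 0 < windowLRVar κ π W φ)
    {K : ℕ → ℕ} (hK : Tendsto K atTop atTop) (hK3 : Tendsto (fun N => (K N : ℝ) ^ 3 / N) atTop (𝓝 0))
    (μ₀ : Measure S) [IsProbabilityMeasure μ₀]
    [IsProbabilityMeasure (Kernel.trajMeasure (X := fun _ : ℕ => S) μ₀
        (fun n : ℕ => κ.comap (fun hh : (i : ↥(Finset.Iic n)) → S => hh ⟨n, Finset.mem_Iic.2 le_rfl⟩)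
          (measurable_pi_apply _)))] :
    TendstoInDistribution (fun (N : ℕ) (x : ℕ → S) =>
        ((Real.sqrt N)⁻¹ * ∑ i ∈ range N, (φ (windowPath W x i) - ∫ x', φ (windowPath W x' 0)
          ∂(Kernel.trajMeasure (X := fun _ : ℕ => S) π
            (fun n : ℕ => κ.comap (fun hh : (i : ↥(Finset.Iic n)) → S => hh ⟨n, Finset.mem_Iic.2 le_rfl⟩)
              (measurable_pi_apply _)))))
          * (Real.sqrt (gammaHat (fun i => φ (windowPath W x i)) N 0
            * (2 * tauIntWindow (rhoHat (fun i => φ (windowPath W x i)) N) (K N))))⁻¹)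
      atTop id (fun _ => Kernel.trajMeasure (X := fun _ : ℕ => S) μ₀
        (fun n : ℕ => κ.comap (fun hh : (i : ↥(Finset.Iic n)) → S => hh ⟨n, Finset.mem_Iic.2 le_rfl⟩)
          (measurable_pi_apply _))) (gaussianReal 0 1) := by
  haveI hπWp : IsProbabilityMeasure ((Kernel.trajMeasure (X := fun _ : ℕ => S) π
      (fun n : ℕ => κ.comap (fun hh : (i : ↥(Finset.Iic n)) → S => hh ⟨n, Finset.mem_Iic.2 le_rfl⟩)
        (measurable_pi_apply _))).map (fun x : ℕ → S => windowPath W x 0)) :=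
    Measure.isProbabilityMeasure_map (measurable_windowPath_at 0).aemeasurable
  haveI hνWp : IsProbabilityMeasure ((Kernel.trajMeasure (X := fun _ : ℕ => S) ν
      (fun n : ℕ => κ.comap (fun hh : (i : ↥(Finset.Iic n)) → S => hh ⟨n, Finset.mem_Iic.2 le_rfl⟩)
        (measurable_pi_apply _))).map (fun x : ℕ → S => windowPath W x 0)) :=
    Measure.isProbabilityMeasure_map (measurable_windowPath_at 0).aemeasurable
  haveI hμWp : IsProbabilityMeasure ((Kernel.trajMeasure (X := fun _ : ℕ => S) μ₀
      (fun n : ℕ => κ.comap (fun hh : (i : ↥(Finset.Iic n)) → S => hh ⟨n, Finset.mem_Iic.2 le_rfl⟩)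
        (measurable_pi_apply _))).map (fun x : ℕ → S => windowPath W x 0)) :=
    Measure.isProbabilityMeasure_map (measurable_windowPath_at 0).aemeasurable
  have hπW := invariant_windowKernel κ W hπ
  have hminW := windowKernel_minorised_of_nHit κ W (ν := ν) (ε := ε) (m := m) hmin
  have hmW : 0 < m + W := by omega
  -- the positivity of the variance in row 13's form
  have hσ' := hσ
  rw [windowLRVar_eq_autocov κ W hπ hφ hC] at hσ'
  -- row 13's studentised CLT for the window chain, started from the law of the initial window
  have hclt := tendstoInDistribution_studentized_timeAverage_of_nHit (κ := windowKernel κ W)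
    ((Kernel.trajMeasure (X := fun _ : ℕ => S) μ₀
      (fun n : ℕ => κ.comap (fun hh : (i : ↥(Finset.Iic n)) → S => hh ⟨n, Finset.mem_Iic.2 le_rfl⟩)
        (measurable_pi_apply _))).map (fun x : ℕ → S => windowPath W x 0))
    hπW hε hminW hmW hφ hC hσ' hK hK3
  -- the centring constant in chain terms
  rw [integral_windowLaw κ W hφ] at hclt
  have hFm : ∀ N : ℕ, Measurable fun Y : ℕ → (Fin (W + 1) → S) =>
      ((Real.sqrt N)⁻¹ * ∑ i ∈ range N, (φ (Y i) - ∫ x', φ (windowPath W x' 0)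
        ∂(Kernel.trajMeasure (X := fun _ : ℕ => S) π
          (fun n : ℕ => κ.comap (fun hh : (i : ↥(Finset.Iic n)) → S => hh ⟨n, Finset.mem_Iic.2 le_rfl⟩)
            (measurable_pi_apply _)))))
        * (Real.sqrt (gammaHat (fun i => φ (Y i)) N 0
          * (2 * tauIntWindow (rhoHat (fun i => φ (Y i)) N) (K N))))⁻¹ := fun N =>
    (measurable_const.mul (Finset.measurable_sum _ fun i _ =>
      (hφ.comp (measurable_pi_apply i)).sub measurable_const)).mul
      (measurable_gammaWindow hφ N (K N)).sqrt.inv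
  -- pull back along the window-path map, whose image law is the window chain
  have key := tendstoInDistribution_comp_of_map_eq (measurable_windowPath W)
    (chain_map_windowPath κ W μ₀) hFm hclt
  exact key

/-- **THE Γ-METHOD ERROR BAR OF A WINDOW FUNCTIONAL HAS ASYMPTOTICALLY EXACT COVERAGE, FROM EVERY
INITIAL LAW.**  Under the hypotheses of
`tendstoInDistribution_chain_studentized_windowAverage_of_nHit`, for every `z > 0`:
`P_{μ₀}{|(√N)⁻¹ Σ_{i<N} (φ(Y_i) − m_φ) · (√(Γ̂^u_N(0) · 2 τ̂^u_{N,K_N}))⁻¹| ≤ z} → gaussianReal 0 1 (Icc (−z) z)`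
— the interval `ū_N ± z √(2 τ̂^u_{N,K_N} Γ̂^u_N(0)/N)` printed for the series `u_i = φ(X_i, …, X_{i+W})`
covers `m_φ` with probability tending to the nominal Gaussian level, neither more nor less. -/
theorem tendsto_measure_chain_studentized_windowAverage_le_of_nHit (hπ : Kernel.Invariant κ π)
    (hε : ε ≠ 0) (hmin : ∀ z, ε • ν ≤ nHit κ m z) (hm : 0 < m)
    {φ : (Fin (W + 1) → S) → ℝ} (hφ : Measurable φ) {C : ℝ} (hC : ∀ v, |φ v| ≤ C)
    (hσ : 0 < windowLRVar κ π W φ)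
    {K : ℕ → ℕ} (hK : Tendsto K atTop atTop) (hK3 : Tendsto (fun N => (K N : ℝ) ^ 3 / N) atTop (𝓝 0))
    (μ₀ : Measure S) [IsProbabilityMeasure μ₀] {z : ℝ} (hz : 0 < z)
    [IsProbabilityMeasure (Kernel.trajMeasure (X := fun _ : ℕ => S) μ₀
        (fun n : ℕ => κ.comap (fun hh : (i : ↥(Finset.Iic n)) → S => hh ⟨n, Finset.mem_Iic.2 le_rfl⟩)
          (measurable_pi_apply _)))] :
    Tendsto (fun N : ℕ => (Kernel.trajMeasure (X := fun _ : ℕ => S) μ₀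
        (fun n : ℕ => κ.comap (fun hh : (i : ↥(Finset.Iic n)) → S => hh ⟨n, Finset.mem_Iic.2 le_rfl⟩)
          (measurable_pi_apply _)))
        {x : ℕ → S | |((Real.sqrt N)⁻¹ * ∑ i ∈ range N, (φ (windowPath W x i)
            - ∫ x', φ (windowPath W x' 0) ∂(Kernel.trajMeasure (X := fun _ : ℕ => S) π
              (fun n : ℕ => κ.comap (fun hh : (i : ↥(Finset.Iic n)) → S => hh ⟨n, Finset.mem_Iic.2 le_rfl⟩)
                (measurable_pi_apply _)))))
          * (Real.sqrt (gammaHat (fun i => φ (windowPath W x i)) N 0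
            * (2 * tauIntWindow (rhoHat (fun i => φ (windowPath W x i)) N) (K N))))⁻¹| ≤ z})
      atTop (𝓝 (gaussianReal 0 1 (Icc (-z) z))) := by
  haveI hπWp : IsProbabilityMeasure ((Kernel.trajMeasure (X := fun _ : ℕ => S) π
      (fun n : ℕ => κ.comap (fun hh : (i : ↥(Finset.Iic n)) → S => hh ⟨n, Finset.mem_Iic.2 le_rfl⟩)
        (measurable_pi_apply _))).map (fun x : ℕ → S => windowPath W x 0)) :=
    Measure.isProbabilityMeasure_map (measurable_windowPath_at 0).aemeasurable
  haveI hνWp : IsProbabilityMeasure ((Kernel.trajMeasure (X := fun _ : ℕ => S) ν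
      (fun n : ℕ => κ.comap (fun hh : (i : ↥(Finset.Iic n)) → S => hh ⟨n, Finset.mem_Iic.2 le_rfl⟩)
        (measurable_pi_apply _))).map (fun x : ℕ → S => windowPath W x 0)) :=
    Measure.isProbabilityMeasure_map (measurable_windowPath_at 0).aemeasurable
  haveI hμWp : IsProbabilityMeasure ((Kernel.trajMeasure (X := fun _ : ℕ => S) μ₀
      (fun n : ℕ => κ.comap (fun hh : (i : ↥(Finset.Iic n)) → S => hh ⟨n, Finset.mem_Iic.2 le_rfl⟩)
        (measurable_pi_apply _))).map (fun x : ℕ → S => windowPath W x 0)) :=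
    Measure.isProbabilityMeasure_map (measurable_windowPath_at 0).aemeasurable
  have hπW := invariant_windowKernel κ W hπ
  have hminW := windowKernel_minorised_of_nHit κ W (ν := ν) (ε := ε) (m := m) hmin
  have hmW : 0 < m + W := by omega
  have hσ' := hσ
  rw [windowLRVar_eq_autocov κ W hπ hφ hC] at hσ'
  -- row 13's exact coverage for the window chain, started from the law of the initial window
  have hcov := tendsto_measure_studentized_timeAverage_le_of_nHit (κ := windowKernel κ W)
    ((Kernel.trajMeasure (X := fun _ : ℕ => S) μ₀
      (fun n : ℕ => κ.comap (fun hh : (i : ↥(Finset.Iic n)) → S => hh ⟨n, Finset.mem_Iic.2 le_rfl⟩)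
        (measurable_pi_apply _))).map (fun x : ℕ → S => windowPath W x 0))
    hπW hε hminW hmW hφ hC hσ' hK hK3 hz
  rw [integral_windowLaw κ W hφ] at hcov
  have hFm : ∀ N : ℕ, Measurable fun Y : ℕ → (Fin (W + 1) → S) =>
      ((Real.sqrt N)⁻¹ * ∑ i ∈ range N, (φ (Y i) - ∫ x', φ (windowPath W x' 0)
        ∂(Kernel.trajMeasure (X := fun _ : ℕ => S) π
          (fun n : ℕ => κ.comap (fun hh : (i : ↥(Finset.Iic n)) → S => hh ⟨n, Finset.mem_Iic.2 le_rfl⟩)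
            (measurable_pi_apply _)))))
        * (Real.sqrt (gammaHat (fun i => φ (Y i)) N 0
          * (2 * tauIntWindow (rhoHat (fun i => φ (Y i)) N) (K N))))⁻¹ := fun N =>
    (measurable_const.mul (Finset.measurable_sum _ fun i _ =>
      (hφ.comp (measurable_pi_apply i)).sub measurable_const)).mul
      (measurable_gammaWindow hφ N (K N)).sqrt.inv
  have hA : ∀ N : ℕ, MeasurableSet {Y : ℕ → (Fin (W + 1) → S) |
      |((Real.sqrt N)⁻¹ * ∑ i ∈ range N, (φ (Y i) - ∫ x', φ (windowPath W x' 0)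
        ∂(Kernel.trajMeasure (X := fun _ : ℕ => S) π
          (fun n : ℕ => κ.comap (fun hh : (i : ↥(Finset.Iic n)) → S => hh ⟨n, Finset.mem_Iic.2 le_rfl⟩)
            (measurable_pi_apply _)))))
        * (Real.sqrt (gammaHat (fun i => φ (Y i)) N 0
          * (2 * tauIntWindow (rhoHat (fun i => φ (Y i)) N) (K N))))⁻¹| ≤ z} := fun N =>
    measurableSet_le (hFm N).abs measurable_const
  -- pull back along the window-path map, whose image law is the window chain
  have key := tendsto_measure_preimage_of_map_eq (measurable_windowPath W)
    (chain_map_windowPath κ W μ₀) hA hcov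
  exact key

/-- **One-step minorisation** (`κ(z, ·) ≥ ε ν`, the certificate shape of rows 8 / 9's samplers): the
same exact asymptotic coverage for window functionals, `m = 1`. -/
theorem tendsto_measure_chain_studentized_windowAverage_le_of_minorised (hπ : Kernel.Invariant κ π)
    (hε : ε ≠ 0) (hmin : ∀ z, ε • ν ≤ κ z)
    {φ : (Fin (W + 1) → S) → ℝ} (hφ : Measurable φ) {C : ℝ} (hC : ∀ v, |φ v| ≤ C)
    (hσ : 0 < windowLRVar κ π W φ)
    {K : ℕ → ℕ} (hK : Tendsto K atTop atTop) (hK3 : Tendsto (fun N => (K N : ℝ) ^ 3 / N) atTop (𝓝 0))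
    (μ₀ : Measure S) [IsProbabilityMeasure μ₀] {z : ℝ} (hz : 0 < z)
    [IsProbabilityMeasure (Kernel.trajMeasure (X := fun _ : ℕ => S) μ₀
        (fun n : ℕ => κ.comap (fun hh : (i : ↥(Finset.Iic n)) → S => hh ⟨n, Finset.mem_Iic.2 le_rfl⟩)
          (measurable_pi_apply _)))] :
    Tendsto (fun N : ℕ => (Kernel.trajMeasure (X := fun _ : ℕ => S) μ₀
        (fun n : ℕ => κ.comap (fun hh : (i : ↥(Finset.Iic n)) → S => hh ⟨n, Finset.mem_Iic.2 le_rfl⟩)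
          (measurable_pi_apply _)))
        {x : ℕ → S | |((Real.sqrt N)⁻¹ * ∑ i ∈ range N, (φ (windowPath W x i)
            - ∫ x', φ (windowPath W x' 0) ∂(Kernel.trajMeasure (X := fun _ : ℕ => S) π
              (fun n : ℕ => κ.comap (fun hh : (i : ↥(Finset.Iic n)) → S => hh ⟨n, Finset.mem_Iic.2 le_rfl⟩)
                (measurable_pi_apply _)))))
          * (Real.sqrt (gammaHat (fun i => φ (windowPath W x i)) N 0
            * (2 * tauIntWindow (rhoHat (fun i => φ (windowPath W x i)) N) (K N))))⁻¹| ≤ z})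
      atTop (𝓝 (gaussianReal 0 1 (Icc (-z) z))) := by
  have hmin' : ∀ z, ε • ν ≤ nHit κ 1 z := fun z => by rw [nHit_one]; exact hmin z
  exact tendsto_measure_chain_studentized_windowAverage_le_of_nHit κ W hπ hε hmin' Nat.one_pos hφ hC
    hσ hK hK3 μ₀ hz

end Chain

end Summit.Ventures.LatticeQCDFlow.Scoring

end
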